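import Summits.BirchSwinnertonDyer.Rank1Residual.X11b.LevelLiftingFromFiniteness
import Summits.BirchSwinnertonDyer.Rank1Residual.X11b.PropagatedLocalConditions
import HarnessLib

/-!
# X11b, route R1 — (P9⁺): lifting local classes at `Σ` AND at `𝔭` to a global class strict away
# from `p` and `Σ` (the global-surgery input of atom (L10))

HONEST FRAMING (cell `b2b-bsdres`, run/shared/lean/b2b/bsd-rank1-residual/, verbatim in every
file): the goal of the cell is to DELETE the COMBINATION-SHAPED residual classes of the
Birch–Swinnerton-Dyer formula for ALL analytic-rank `≤ 1` elliptic curves over `ℚ` — "full BSD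
formula for every rank `≤ 1` curve in class `C`" assembled STRICTLY from published theorems — so
that the rank-`≤ 1` remainder becomes exactly the CONSTRUCTION-SHAPED classes, which are TYPED
(missing-input `Prop`s), NOT attempted. This is not "finishing BSD". Sub-cell
`b2b-bsdres-multr1-p1` (X11b, route R1 = Castella 2018 Thm. A re-proved along the author's
erratum); a RESEARCH ROUTE; no claim beyond the stated class; X11b stays CONSTRUCTION-SHAPED;
nothing here changes a label; no named fact is minted (one definition with a body — a Selmer
structure — and theorems; no `sorry`); CONDITIONAL on the cited
`poitouTate_selmerStructure_duality K`.

## What this file does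

The second half of JSW17 Lemma 3.3.3 (`H¹_{ac}(K, M)_Γ = 0` from `H¹(K^S/K, M)_Γ = 0`) needs, in
route R1's `K_∞`-formulation, GLOBAL SURGERY: a class of `H¹(K, E[p^∞])` with prescribed
localisations at finitely many places `Σ` away from `p` AND AT `𝔭`, locally trivial at every other
finite place away from `p` (no condition at the other places above `p`).  Gen 15's
`levelLiftingAt_of_finite` (JSW17 Prop. 3.3.2 = atom (P9)) prescribes on `Σ` only, the lift being
STRICT at `𝔭`.  This file is the `𝔭`-augmented variant, from the SAME inputs:

* `upperStructureP W p N 𝔭 Σ = 𝓖⁺` — Castella's propagated structure `𝓛^{(N),Σ}` RELAXED at `𝔭`;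
  `𝓖⁺` is unramified outside `T ⊇ ∞ ∪ {v∣p} ∪ Σ ∪ {bad}` and `lowerStructure(Σ⁺) ≤ 𝓖⁺`,
  `Σ⁺ = Σ ∪ {𝔭}`;
* **`levelLiftingP_of_finite`**: under hypothesis (iv) at `𝔭` (`E[p^∞]^{Γ_{K_𝔭}} = 0`, so that
  `𝓛^{(N)}_𝔭 = 0`, `acLevelStructure_self_eq_bot_of_noInvariants`) and the hypotheses of gen 15's
  theorem (PT fact; all infinite places complex; `E[p^∞]^{Γ_K} = 0`; `𝔭, 𝔮 ∣ p`, `𝔮 ≠ 𝔭`; `Σ` away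
  from `p`; `T`; `Finite (H¹_{𝓛^{ac,R}_𝔮}(K, E[p^∞]))`): every family
  `τ_v ∈ H¹(K_v, E[p^∞])[p^{K₀}]`,
  `v ∈ Σ⁺`, is `loc_v (H¹(ι_N) x)` for some `x ∈ H¹_{𝓖⁺}(K, E[p^N])`.  The obstruction is gen 15's
  `sum_localTatePairingZMod_liftFamily_eq_zero` read with `Σ⁺` (its proof is uniform in the places
  of the family; the dual structure of `lowerStructure(Σ⁺)` is already relaxed at `𝔭` and its
  classes transport into the same finite group `Sel_𝔮^{R}(K, E[p^∞])`);
* `localization_map_primaryInclusion_eq_zero_of_mem_upperStructureP` — the resulting global class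
  `H¹(ι_N) x ∈ H¹(K, E[p^∞])` is locally ZERO at every finite `v ∤ p` outside `Σ`.

References: [JetchevSkinnerWan2017] Prop. 3.3.2, Lemma 3.3.3 (arXiv:1512.06894 pp. 11–12);
[Howard2004HeegnerKolyvagin] Thm. 2.1.11; [Castella2018] Def. 2.2, Thm. 2.3 (arXiv:1704.06608 p. 5).
-/

noncomputable section

open scoped Classical

open CategoryTheory Field NumberField IsDedekindDomain
open Literature.NumberTheory.EllipticCurves Literature.NumberTheory.EllipticCurves.GreenbergSelmer
open Literature.NumberTheory.GaloisRepresentations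
open Literature.NumberTheory.GaloisRepresentations.DiscreteGaloisModule (SelmerStructure TateDual
  tateDual localTatePairingZMod unramifiedSubgroup)
open Literature.NumberTheory.GaloisCohomology
open scoped ContRepresentation

namespace Summit.BirchSwinnertonDyer.Rank1Residual.X11b.AcSelmer

open Summit.BirchSwinnertonDyer.Rank1Residual.X11b.LocBridge
open Summit.BirchSwinnertonDyer.Rank1Residual.X11b.Levels

-- Cup products need `LocallyCompactSpace Γ`; finiteness of `E[p^k]`, `NeZero (p^k)`: local
-- instances.
attribute [local instance] absoluteGaloisGroup_compactSpace Levels.neZero_pow finite_geomTorsion_pow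

variable {K : Type} [Field K] [NumberField K] (W : WeierstrassCurve K) [W.IsElliptic] (p : ℕ)
  [Fact p.Prime] (N : ℕ) (𝔭 : HeightOneSpectrum (𝓞 K)) (S : Set (HeightOneSpectrum (𝓞 K)))

/-! ## §1. The upper structure `𝓖⁺`: Castella's level structure relaxed at `𝔭` -/

/-- **`𝓖⁺ = 𝓛^{(N),Σ}` relaxed at `𝔭`**: `⊤` at `𝔭`, Castella's propagated level structure
`acLevelStructure W p N 𝔭 Σ` elsewhere. A definition; nothing asserted.
[cite: Castella2018, Def. 2.2 (arXiv:1704.06608 p. 5)]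
[cite: Howard2004HeegnerKolyvagin, Def. 2.1.1 (arXiv:1202.6340 p. 5)] -/
def upperStructureP : SelmerStructure (W.torsionGaloisModule ((p ^ N : ℕ) : ℤ)) := fun v ↦
  if v = Sum.inr 𝔭 then ⊤ else acLevelStructure W p N 𝔭 S v

omit [W.IsElliptic] [Fact p.Prime] in
/-- `𝓖⁺ = ⊤` at `𝔭`. [folklore] -/
@[simp]
theorem upperStructureP_self : upperStructureP W p N 𝔭 S (Sum.inr 𝔭) = ⊤ := by
  simp [upperStructureP]

omit [W.IsElliptic] [Fact p.Prime] in
/-- `𝓖⁺ = 𝓛^{(N),Σ}` off `𝔭`. [folklore] -/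
theorem upperStructureP_of_ne {v : Place K} (hv : v ≠ Sum.inr 𝔭) :
    upperStructureP W p N 𝔭 S v = acLevelStructure W p N 𝔭 S v := by
  simp [upperStructureP, hv]

omit [W.IsElliptic] [Fact p.Prime] in
/-- `𝓛^{(N),Σ} ≤ 𝓖⁺`. [folklore] -/
theorem acLevelStructure_le_upperStructureP :
    acLevelStructure W p N 𝔭 S ≤ upperStructureP W p N 𝔭 S := by
  intro v
  by_cases hv : v = Sum.inr 𝔭
  · subst hv; rw [upperStructureP_self]; exact le_top
  · rw [upperStructureP_of_ne W p N 𝔭 S hv]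

omit [W.IsElliptic] [Fact p.Prime] in
/-- `lowerStructure(Σ') ≤ 𝓖⁺` for any `Σ' ⊆ Σ ∪ {𝔭}` — here for `Σ⁺ = insert 𝔭 Σ`: the two level
structures `𝓛^{(N),Σ⁺}` and `𝓛^{(N),Σ}` agree (Castella's structure is strict at `𝔭` regardless of
`Σ`). [folklore] -/
theorem acStructure_insert_self :
    acStructure (primaryGaloisModule W p) p 𝔭 (insert 𝔭 S) =
      acStructure (primaryGaloisModule W p) p 𝔭 S := by
  funext v
  rcases v with w | v
  · rfl
  · rw [acStructure_inr, acStructure_inr]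
    by_cases hv : v = 𝔭
    · subst hv; simp
    · simp [Set.mem_insert_iff, hv]

omit [W.IsElliptic] [Fact p.Prime] in
/-- Hence `𝓛^{(N),Σ⁺} = 𝓛^{(N),Σ}`. [folklore] -/
theorem acLevelStructure_insert_self :
    acLevelStructure W p N 𝔭 (insert 𝔭 S) = acLevelStructure W p N 𝔭 S := by
  unfold acLevelStructure
  rw [acStructure_insert_self]

omit [W.IsElliptic] [Fact p.Prime] in
/-- `lowerStructure(Σ⁺) ≤ 𝓖⁺`. [folklore] -/
theorem lowerStructure_insert_le_upperStructureP (T : Finset (Place K)) :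
    lowerStructure W p N 𝔭 (insert 𝔭 S) T ≤ upperStructureP W p N 𝔭 S :=
  le_trans (lowerStructure_le W p N 𝔭 (insert 𝔭 S) T)
    (by rw [acLevelStructure_insert_self]; exact acLevelStructure_le_upperStructureP W p N 𝔭 S)

/-- `𝓖⁺` is unramified outside any `T ⊇ ∞ ∪ {v∣p} ∪ Σ ∪ {bad}` (it agrees with `𝓛^{(N),Σ}` off
`𝔭 ∈ T`). [cite: Howard2004HeegnerKolyvagin, Def. 2.1.10 (arXiv:1202.6340 p. 6)] -/
theorem upperStructureP_isUnramifiedOutside (T : Finset (Place K))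
    (h𝔭 : ((p : ℕ) : 𝓞 K) ∈ 𝔭.asIdeal)
    (hinf : ∀ w : InfinitePlace K, (Sum.inl w : Place K) ∈ T)
    (hp : ∀ v : HeightOneSpectrum (𝓞 K), ((p : ℕ) : 𝓞 K) ∈ v.asIdeal → (Sum.inr v : Place K) ∈ T)
    (hSig : ∀ v ∈ S, (Sum.inr v : Place K) ∈ T)
    (hbad : ∀ v : HeightOneSpectrum (𝓞 K), ¬ W.HasGoodReductionAt v → (Sum.inr v : Place K) ∈ T) :
    SelmerStructure.IsUnramifiedOutside (upperStructureP W p N 𝔭 S) T := by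
  refine ⟨hinf, fun v hv ↦ ?_⟩
  have hne : (Sum.inr v : Place K) ≠ Sum.inr 𝔭 := fun h ↦ hv (h ▸ hp 𝔭 h𝔭)
  rw [upperStructureP_of_ne W p N 𝔭 S hne]
  exact (acLevelStructure_isUnramifiedOutside W p N 𝔭 S T hinf hp hSig hbad).2 v hv

omit [W.IsElliptic] [Fact p.Prime] in
/-- A class of `H¹_{𝓖⁺}(K, E[p^N])` maps, under `H¹(ι_N)`, to a class of `H¹(K, E[p^∞])` that is
locally ZERO at every finite `v ∤ p` outside `Σ` (there `𝓖⁺_v = 𝓛^{(N)}_v` is the propagated zero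
condition). [cite: Castella2018, Def. 2.2 (arXiv:1704.06608 p. 5)] -/
theorem localization_map_primaryInclusion_eq_zero_of_mem_upperStructureP
    {x : galoisCohomology (W.torsionGaloisModule ((p ^ N : ℕ) : ℤ)) 1}
    (hx : x ∈ (upperStructureP W p N 𝔭 S).selmerGroup) {v : HeightOneSpectrum (𝓞 K)}
    (h𝔭 : ((p : ℕ) : 𝓞 K) ∈ 𝔭.asIdeal) (hpv : ((p : ℕ) : 𝓞 K) ∉ v.asIdeal) (hvS : v ∉ S) :
    galoisCohomology.localization (primaryGaloisModule W p) (Sum.inr v) 1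
      (galoisCohomology.map (primaryInclusion W p N) 1 x) = 0 := by
  have hv𝔭 : v ≠ 𝔭 := fun h ↦ hpv (h ▸ h𝔭)
  have hxv := (SelmerStructure.mem_selmerGroup_iff _ x).1 hx (Sum.inr v)
  rw [upperStructureP_of_ne W p N 𝔭 S (fun h ↦ hv𝔭 (Sum.inr_injective h)),
    acLevelStructure_eq_ker_of W p N 𝔭 S
      (acStructure_of_not_mem (primaryGaloisModule W p) p 𝔭 S hpv hvS)] at hxv
  rw [localization_map_one]
  exact (AddMonoidHom.mem_ker).1 hxv

/-! ## §2. The lift with prescribed values on `Σ⁺ = Σ ∪ {𝔭}` -/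

/-- **(P9⁺): lifting with prescribed localisations on `Σ` AND at `𝔭`.**  Hypotheses as in gen 15's
`levelLiftingAt_of_finite` (PT fact `poitouTate_selmerStructure_duality K`; all infinite places
complex; `E[p^∞]^{Γ_K} = 0`; `𝔭, 𝔮 ∣ p`, `𝔮 ≠ 𝔭`; `Σ` away from `p`; `T ⊇ ∞ ∪ {v∣p} ∪ Σ ∪ {bad}`;
`Finite (H¹_{𝓛^{ac,R}_𝔮}(K, E[p^∞]))`) PLUS hypothesis (iv) at `𝔭`: `E[p^∞]^{Γ_{K_𝔭}} = 0`.  Then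
for every `K₀` and every family `τ_v ∈ H¹(K_v, E[p^∞])`, `v ∈ Σ⁺ = Σ ∪ {𝔭}`, killed by `p^{K₀}`,
there are `N` and `x ∈ H¹_{𝓖⁺}(K, E[p^N])` with `loc_v (H¹(ι_N) x) = τ_v` for all `v ∈ Σ⁺`.  Proof =
gen 15's,
with `SelmerComplement` applied to `lowerStructure(Σ⁺) ≤ 𝓖⁺` and the test family `liftFamily` on
`Σ⁺`; the obstruction vanishes by `sum_localTatePairingZMod_liftFamily_eq_zero` (read with `Σ⁺`); at
`v ∈ Σ⁺` the lower structure is `0` (`Σ`: by definition; `𝔭`: by (iv)), so the lift hits `τ_v`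
exactly.
[cite: JetchevSkinnerWan2017, Prop. 3.3.2 and Lemma 3.3.3 (arXiv:1512.06894 pp. 11–12)]
[cite: Howard2004HeegnerKolyvagin, Thm. 2.1.11 (arXiv:1202.6340 p. 6)] -/
theorem levelLiftingP_of_finite (T : Finset (Place K)) (hPT : poitouTate_selmerStructure_duality K)
    (hK : ∀ w : InfinitePlace K, w.IsComplex)
    (hΓ : ∀ Q : W.geomPrimaryTorsion p,
      (∀ σ : absoluteGaloisGroup K, primaryGaloisModule W p σ Q = Q) → Q = 0)
    (hΓ𝔭 : ∀ Q : W.geomPrimaryTorsion p,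
      (∀ σ : absoluteGaloisGroup (𝔭.adicCompletion K),
        GaloisRep.restrictField (𝔭.adicCompletion K) (primaryGaloisModule W p) σ Q = Q) → Q = 0)
    {𝔮 : HeightOneSpectrum (𝓞 K)} (h𝔭 : ((p : ℕ) : 𝓞 K) ∈ 𝔭.asIdeal)
    (h𝔮 : ((p : ℕ) : 𝓞 K) ∈ 𝔮.asIdeal) (hne : 𝔮 ≠ 𝔭)
    (hSp : ∀ v ∈ S, ((p : ℕ) : 𝓞 K) ∉ v.asIdeal)
    (hinf : ∀ w : InfinitePlace K, (Sum.inl w : Place K) ∈ T)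
    (hp : ∀ v : HeightOneSpectrum (𝓞 K), ((p : ℕ) : 𝓞 K) ∈ v.asIdeal → (Sum.inr v : Place K) ∈ T)
    (hSig : ∀ v ∈ S, (Sum.inr v : Place K) ∈ T)
    (hbad : ∀ v : HeightOneSpectrum (𝓞 K), ¬ W.HasGoodReductionAt v → (Sum.inr v : Place K) ∈ T)
    (hfin : Finite ((acStructure (primaryGaloisModule W p) p 𝔮
      {v | (Sum.inr v : Place K) ∈ T ∧ ((p : ℕ) : 𝓞 K) ∉ v.asIdeal}).selmerGroup))
    (K₀ : ℕ) (τ : ∀ v : (insert 𝔭 S : Set (HeightOneSpectrum (𝓞 K))),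
      galoisCohomology
        ((primaryGaloisModule W p).toLocal (Sum.inr (v : HeightOneSpectrum (𝓞 K)))) 1)
    (hτ : ∀ v, p ^ K₀ • τ v = 0) :
    ∃ (N : ℕ) (x : galoisCohomology (W.torsionGaloisModule ((p ^ N : ℕ) : ℤ)) 1),
      x ∈ (upperStructureP W p N 𝔭 S).selmerGroup ∧
        ∀ v : (insert 𝔭 S : Set (HeightOneSpectrum (𝓞 K))),
          galoisCohomology.localization (primaryGaloisModule W p)
            (Sum.inr (v : HeightOneSpectrum (𝓞 K))) 1
            (galoisCohomology.map (primaryInclusion W p N) 1 x) = τ v := by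
  have hdiv : W.zsmul_geomPoints_surjective := W.zsmul_geomPoints_surjective_holds
  have hSig' : ∀ v ∈ insert 𝔭 S, (Sum.inr v : Place K) ∈ T := by
    intro v hv
    rcases Set.mem_insert_iff.1 hv with rfl | hv
    · exact hp v h𝔭
    · exact hSig v hv
  -- the exponent `e ≥ 1` of the relaxed conjugate group and the level `N = K₀ + e`
  haveI := hfin
  obtain ⟨e, he1, he⟩ := exists_pow_nsmul_eq_zero_of_finite
    ((acStructure (primaryGaloisModule W p) p 𝔮
      {v | (Sum.inr v : Place K) ∈ T ∧ ((p : ℕ) : 𝓞 K) ∉ v.asIdeal}).selmerGroup)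
  -- the Poitou–Tate family at level `p^N`
  obtain ⟨inv, hperf, -, hur, hcompl⟩ := hPT (p ^ (K₀ + e))
  -- local lifts `s_v ∈ H¹(K_v, E[p^{K₀}])` of the `τ_v`
  have hs : ∀ v : (insert 𝔭 S : Set (HeightOneSpectrum (𝓞 K))),
      ∃ sv : galoisCohomology (GaloisRep.restrictField
      (Place.Completion (Sum.inr (v : HeightOneSpectrum (𝓞 K)) : Place K))
      (W.torsionGaloisModule ((p ^ K₀ : ℕ) : ℤ))) 1,
      galoisCohomology.map ((primaryInclusion W p K₀).restrictField
        (Place.Completion (Sum.inr (v : HeightOneSpectrum (𝓞 K)) : Place K))) 1 sv = τ v := fun v ↦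
    (mem_range_map_primaryInclusion_restrictField_iff W p K₀ _ hdiv (τ v)).mpr (hτ v)
  choose s hs using hs
  -- the Poitou–Tate data
  have hMn : ∀ m : W.geomTorsion ((p ^ (K₀ + e) : ℕ) : ℤ), (p ^ (K₀ + e)) • m = 0 := fun m ↦
    AddSubgroup.torsionBy.nsmul m
  have hTout : ∀ v : HeightOneSpectrum (𝓞 K), (Sum.inr v : Place K) ∉ T →
      ((p ^ (K₀ + e) : ℕ) : 𝓞 K) ∉ v.asIdeal ∧
        GaloisRep.IsUnramifiedAt v (W.torsionGaloisModule ((p ^ (K₀ + e) : ℕ) : ℤ)) := by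
    intro v hv
    have hpv : ((p : ℕ) : 𝓞 K) ∉ v.asIdeal := fun h ↦ hv (hp v h)
    have hgood : W.HasGoodReductionAt v := by
      by_contra hbad'
      exact hv (hbad v hbad')
    exact ⟨natCast_pow_not_mem p hpv _,
      isUnramifiedAt_torsionGaloisModule W hgood (intCast_pow_not_mem p hpv _)⟩
  have ht : ∀ v ∈ T, liftFamily W p K₀ e s v ∈ upperStructureP W p (K₀ + e) 𝔭 S v := by
    intro v _
    rcases v with w | v
    · rw [liftFamily_inl]; exact zero_mem _
    · by_cases hvI : v ∈ insert 𝔭 S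
      · by_cases hv𝔭 : v = 𝔭
        · subst hv𝔭
          rw [upperStructureP_self]; exact AddSubgroup.mem_top _
        · have hvS : v ∈ S := by
            rcases Set.mem_insert_iff.1 hvI with h | h
            · exact (hv𝔭 h).elim
            · exact h
          rw [upperStructureP_of_ne W p (K₀ + e) 𝔭 S (fun h ↦ hv𝔭 (Sum.inr_injective h)),
            acLevelStructure_eq_top_of_mem_S W p (K₀ + e) 𝔭 S hvS hv𝔭]
          exact AddSubgroup.mem_top _
      · rw [liftFamily_inr_of_not_mem W p K₀ e s hvI]; exact zero_mem _
  -- Poitou–Tate: the lift exists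
  obtain ⟨x, hx, hxt⟩ := (hcompl (W.torsionGaloisModule ((p ^ (K₀ + e) : ℕ) : ℤ)) hMn T hTout
    (lowerStructure W p (K₀ + e) 𝔭 (insert 𝔭 S) T) (upperStructureP W p (K₀ + e) 𝔭 S)
    (lowerStructure_insert_le_upperStructureP W p (K₀ + e) 𝔭 S T)
    (lowerStructure_isUnramifiedOutside W p (K₀ + e) 𝔭 (insert 𝔭 S) T hinf hp hSig' hbad)
    (upperStructureP_isUnramifiedOutside W p (K₀ + e) 𝔭 S T h𝔭 hinf hp hSig hbad)).1
    (liftFamily W p K₀ e s) ht fun y hy ↦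
      sum_localTatePairingZMod_liftFamily_eq_zero W p 𝔭 T K₀ e hK hΓ h𝔮 hne hSig' hbad he1 he hperf
        hur s hy
  refine ⟨K₀ + e, x, hx, fun v ↦ ?_⟩
  have hv := hxt (Sum.inr (v : HeightOneSpectrum (𝓞 K))) (hSig' v v.2)
  -- the lower structure is `0` at every place of `Σ⁺`
  have h0 : lowerStructure W p (K₀ + e) 𝔭 (insert 𝔭 S) T
      (Sum.inr (v : HeightOneSpectrum (𝓞 K))) = ⊥ := by
    by_cases hv𝔭 : (v : HeightOneSpectrum (𝓞 K)) = 𝔭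
    · rw [lowerStructure_inr_of_not W p (K₀ + e) 𝔭 (insert 𝔭 S) T
        (fun h ↦ h.2 (by rw [hv𝔭]; exact h𝔭)), hv𝔭]
      exact acLevelStructure_self_eq_bot_of_noInvariants W p (K₀ + e) 𝔭 (insert 𝔭 S) hΓ𝔭
    · have hvS : (v : HeightOneSpectrum (𝓞 K)) ∈ S := by
        rcases Set.mem_insert_iff.1 v.2 with h | h
        · exact (hv𝔭 h).elim
        · exact h
      exact lowerStructure_inr_of_mem W p (K₀ + e) 𝔭 (insert 𝔭 S) T (hSig' v v.2) (hSp _ hvS)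
  rw [h0, AddSubgroup.mem_bot, sub_eq_zero, liftFamily_inr_of_mem W p K₀ e s v.2] at hv
  rw [localization_map_one, hv, map_primaryInclusion_map_levelIncl_restrictField]
  exact hs v

end Summit.BirchSwinnertonDyer.Rank1Residual.X11b.AcSelmer

end
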